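import Literature.Topology.FourManifolds.SurfaceTorusUniqueness
import Literature.Topology.FourManifolds.SurfaceGenusZeroSphere
import Literature.Topology.FourManifolds.ClosedOrientableSurfaces
import Literature.Topology.FourManifolds.IntersectionLatticeOrientationIffProofs
import HarnessLib

/-!
# Closed connected orientable surfaces with `rank H₁ = 2` are tori (classification in genus one)

Topic `Literature/Topology/FourManifolds`; written for the fact seat
`provefact-Literature.Topology.FourManifolds.nonempty_diffeomorph_sphere_four_of_sblf_genus_one_noLefschetz`
(Baykur–Kamada 2015, Lemma 11 / §5: the regular fibres of the higher-genus side of a genus-one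
simplified broken Lefschetz fibration — closed connected oriented surfaces `F` with
`H₁(F; ℤ) ≅ ℤ²` — are tori, "`X_h ≅ T² × D²`").  The genus-one case of the classification of
closed orientable surfaces in the homological normalisation of the tree's fibration vocabulary
(`IsSimplifiedBrokenLefschetzFibration`: genus read as `H₁(F; ℤ) ≅ ℤ^{2g}`), sibling of the
genus-zero file `SurfaceGenusZeroSphere.lean`.  Everything here is **proved**; no definition and
no named fact is introduced.

* `exists_isMorse_one_two_one_of_finrank_eq_two` — **a closed connected orientable smooth surface
  with `rank_ℤ H₁ = 2` carries a Morse function with exactly one minimum, two saddles and one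
  maximum**: a smooth orientation is a homological `ℤ`-orientation (Bredon VI.7.15,
  `isOrientableOver_int_of_isOrientable_holds`), so `H₂ ≅ ℤ` (Hatcher 3.26 (a)) and
  `χ = 1 - 2 + 1 = 0`; a Morse function with one minimum and one maximum exists (Matsumoto
  Thm. 3.35 / Milnor 1965 Thm. 8.1, `exists_isMorse_ncard_criticalSetOfIndex_eq_one_holds`) and
  the Morse equality `#Crit₀ - #Crit₁ + #Crit₂ = χ` (`SphereMorseCount.morseCount_eq_relEuler`)
  gives exactly two saddles.
* `nonempty_diffeomorph_of_isOrientable_of_finrank_eq_two` — **any two closed connected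
  orientable smooth surfaces with `rank_ℤ H₁ = 2` are diffeomorphic** (Hirsch, *Differential
  Topology* (1976), Ch. 9 §3, Thm. 3.5 with Thm. 3.7 / Thm. 3.11: compact connected orientable
  surfaces are classified by the genus, here genus one), by the uniqueness of the torus
  (`nonempty_diffeomorph_of_isMorse_one_two_one`, `SurfaceTorusUniqueness.lean`);
  `…_of_linearEquiv_fin_two` is the same with the hypotheses in the shape of the SBLF fibre
  clauses `(Fin (2 * 1) → ℤ) ≃ₗ[ℤ] H₁(F; ℤ)`.
* `nonempty_homeomorph_circle_prod_circle_of_isOrientable_of_finrank_eq_two` — in particular such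
  a surface is homeomorphic to `S¹ × S¹` (comparison with the tree's torus model
  `exists_twoTorus_model`, `ClosedOrientableSurfaces.lean`).

## References

* M. W. Hirsch, *Differential Topology*, GTM 33 (1976), Ch. 9 §3, Thms. 3.5, 3.7, 3.11.
  [HirschDT1976]
* Y. Matsumoto, *An introduction to Morse theory*, AMS (2001), §1.5 (b), Thm. 3.35. [Matsumoto2001]
* A. Hatcher, *Algebraic Topology* (2002), Thm. 3.26, Example 2A.2. [HatcherAT2002]
* R. İ. Baykur, S. Kamada, J. Math. Soc. Japan 67 (2015), §5, Lemma 11. [BaykurKamada2015]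
-/

noncomputable section

open scoped Manifold ContDiff Topology
open Set Module
open Literature.AlgebraicTopology.SingularHomology

namespace Literature.Topology.FourManifolds

/-- **A closed connected orientable smooth surface with `rank_ℤ H₁ = 2` has a Morse function of
type `(1, 2, 1)`** (one minimum, two saddles, one maximum): `χ = b₀ - b₁ + b₂ = 1 - 2 + 1 = 0`
(`H₂ ≅ ℤ` from the orientation, Hatcher Thm. 3.26 (a)), a Morse function with one minimum and one
maximum exists (`exists_isMorse_ncard_criticalSetOfIndex_eq_one_holds 2`, Matsumoto Thm. 3.35),
and the Morse equality (`SphereMorseCount.morseCount_eq_relEuler`, Milnor 1965 Thm. 7.4) counts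
the saddles. [cite: Matsumoto2001, Thm. 3.35] [cite: HatcherAT2002, Thm. 3.26] -/
theorem exists_isMorse_one_two_one_of_finrank_eq_two (S : Type)
    [TopologicalSpace S] [T2Space S] [SecondCountableTopology S] [CompactSpace S]
    [ConnectedSpace S] [ChartedSpace (EuclideanSpace ℝ (Fin 2)) S] [IsManifold (𝓡 2) ∞ S]
    (ho : IsOrientable (𝓡 2) S) (h1 : Module.finrank ℤ (singularHomology ℤ ℤ S 1) = 2) :
    ∃ (f : S → ℝ) (_ : IsMorse (𝓡 2) f) (pbot ptop : S),
      criticalSetOfIndex (𝓡 2) f 0 = {pbot} ∧ criticalSetOfIndex (𝓡 2) f 2 = {ptop} ∧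
        (criticalSetOfIndex (𝓡 2) f 1).ncard = 2 := by
  haveI : Nonempty S := ConnectedSpace.toNonempty
  -- `b₂ = 1` from the orientation
  obtain ⟨μ⟩ := isOrientableOver_int_of_isOrientable_holds S ho
  obtain ⟨e2⟩ := nonempty_singularHomology_top_iso_holds (R := ℤ) (X := S) 2 μ
  have h2 : Module.finrank ℤ (singularHomology ℤ ℤ S 2) = 1 := by
    rw [e2.toLinearEquiv.finrank_eq]
    change Module.finrank ℤ (ULift.{0} ℤ) = 1
    rw [finrank_ulift, Module.finrank_self]
  -- `b₀ = 1`
  haveI : LocallyPathConnectedSpace S :=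
    ChartedSpace.locallyPathConnectedSpace (EuclideanSpace ℝ (Fin 2)) S
  haveI : PathConnectedSpace S := pathConnectedSpace_iff_connectedSpace.mpr inferInstance
  have h0 : Module.finrank ℤ (singularHomology ℤ ℤ S 0) = 1 := by
    rw [finrank_singularHomology_zero_of_pathConnectedSpace ℤ ℤ (X := S), Module.finrank_self]
  -- homology is finitely generated and vanishes above the dimension
  have hfin : FinRelHomology ℤ ℤ S ∅ 3 :=
    FinRelHomology.empty_of_absolute
      (fun j => finite_singularHomology_of_compactSpace_holds ℤ S 2 j)
      (fun _ hj => isZero_singularHomology_of_lt_holds ℤ ℤ S 2 (by omega))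
  -- a Morse function with one minimum and one maximum; the Morse equality counts the saddles
  obtain ⟨f, hf, hc0, hc2⟩ := exists_isMorse_ncard_criticalSetOfIndex_eq_one_holds 2 S
  have hME : ∑ k ∈ Finset.range 3, (-1 : ℤ) ^ k * ((criticalSetOfIndex (𝓡 2) f k).ncard : ℤ) =
      relEuler ℤ ℤ S ∅ :=
    SphereMorseCount.morseCount_eq_relEuler (n := 1) hf
  rw [hfin.relEuler_empty_eq_sum] at hME
  simp only [Finset.sum_range_succ, Finset.sum_range_zero, h0, h1, h2, hc0, hc2] at hME
  push_cast at hME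
  have hc1 : (criticalSetOfIndex (𝓡 2) f 1).ncard = 2 := by
    zify
    linear_combination -hME
  obtain ⟨pbot, hbot⟩ := Set.ncard_eq_one.mp hc0
  obtain ⟨ptop, htop⟩ := Set.ncard_eq_one.mp hc2
  exact ⟨f, hf, pbot, ptop, hbot, htop, hc1⟩

/-- **Classification of closed orientable surfaces in genus one**: any two closed connected
orientable smooth surfaces with `rank_ℤ H₁ = 2` are diffeomorphic (Hirsch, *Differential Topology*
(1976), Ch. 9 §3, Thm. 3.5 with Thms. 3.7, 3.11 — compact connected orientable surfaces without
boundary are classified by the genus).  Both carry Morse functions of type `(1, 2, 1)`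
(`exists_isMorse_one_two_one_of_finrank_eq_two`) and the uniqueness of the torus
(`nonempty_diffeomorph_of_isMorse_one_two_one`) applies.
[cite: HirschDT1976, Ch. 9 §3, Thm. 3.5 and Thm. 3.11] -/
theorem nonempty_diffeomorph_of_isOrientable_of_finrank_eq_two (S₁ S₂ : Type)
    [TopologicalSpace S₁] [T2Space S₁] [SecondCountableTopology S₁] [CompactSpace S₁]
    [ConnectedSpace S₁] [ChartedSpace (EuclideanSpace ℝ (Fin 2)) S₁] [IsManifold (𝓡 2) ∞ S₁]
    [TopologicalSpace S₂] [T2Space S₂] [SecondCountableTopology S₂] [CompactSpace S₂]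
    [ConnectedSpace S₂] [ChartedSpace (EuclideanSpace ℝ (Fin 2)) S₂] [IsManifold (𝓡 2) ∞ S₂]
    (ho₁ : IsOrientable (𝓡 2) S₁) (h₁ : Module.finrank ℤ (singularHomology ℤ ℤ S₁ 1) = 2)
    (ho₂ : IsOrientable (𝓡 2) S₂) (h₂ : Module.finrank ℤ (singularHomology ℤ ℤ S₂ 1) = 2) :
    Nonempty (S₁ ≃ₘ⟮𝓡 2, 𝓡 2⟯ S₂) := by
  obtain ⟨f₁, hf₁, pbot₁, ptop₁, hbot₁, htop₁, hsad₁⟩ :=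
    exists_isMorse_one_two_one_of_finrank_eq_two S₁ ho₁ h₁
  obtain ⟨f₂, hf₂, pbot₂, ptop₂, hbot₂, htop₂, hsad₂⟩ :=
    exists_isMorse_one_two_one_of_finrank_eq_two S₂ ho₂ h₂
  exact nonempty_diffeomorph_of_isMorse_one_two_one ho₁.some hf₁ hbot₁ htop₁ hsad₁ ho₂.some hf₂
    hbot₂ htop₂ hsad₂

/-- **Oriented genus-one surfaces, in the shape of the SBLF fibre clauses, are all diffeomorphic.**
Two compact connected orientable `C^∞` surfaces `S₁, S₂ : Type` without boundary with
`(Fin (2 * 1) → ℤ) ≃ₗ[ℤ] H₁(Sᵢ; ℤ)` — the reading "genus `1`" of the clauses `fibre`,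
`exists_higher` of `IsSimplifiedBrokenLefschetzFibration o f L 0` — are diffeomorphic.  This is
the fibre-identification step "the higher-genus regular fibre is `T²`, so `X_h ≅ T² × D²`" of
the genus-one classification (Baykur–Kamada 2015, §5, Lemma 11; Hayano 2011, §2.3), granted the
orientation of the fibre. [cite: HirschDT1976, Ch. 9 §3, Thm. 3.5 and Thm. 3.11]
[cite: BaykurKamada2015, §5, Lemma 11] -/
theorem nonempty_diffeomorph_of_isOrientable_of_linearEquiv_fin_two (S₁ S₂ : Type)
    [TopologicalSpace S₁] [T2Space S₁] [SecondCountableTopology S₁] [CompactSpace S₁]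
    [ConnectedSpace S₁] [ChartedSpace (EuclideanSpace ℝ (Fin 2)) S₁] [IsManifold (𝓡 2) ∞ S₁]
    [TopologicalSpace S₂] [T2Space S₂] [SecondCountableTopology S₂] [CompactSpace S₂]
    [ConnectedSpace S₂] [ChartedSpace (EuclideanSpace ℝ (Fin 2)) S₂] [IsManifold (𝓡 2) ∞ S₂]
    (ho₁ : IsOrientable (𝓡 2) S₁)
    (h₁ : Nonempty ((Fin (2 * 1) → ℤ) ≃ₗ[ℤ] singularHomology ℤ ℤ S₁ 1))
    (ho₂ : IsOrientable (𝓡 2) S₂)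
    (h₂ : Nonempty ((Fin (2 * 1) → ℤ) ≃ₗ[ℤ] singularHomology ℤ ℤ S₂ 1)) :
    Nonempty (S₁ ≃ₘ⟮𝓡 2, 𝓡 2⟯ S₂) := by
  obtain ⟨e₁⟩ := h₁
  obtain ⟨e₂⟩ := h₂
  refine nonempty_diffeomorph_of_isOrientable_of_finrank_eq_two S₁ S₂ ho₁ ?_ ho₂ ?_
  · rw [← e₁.finrank_eq]
    simp
  · rw [← e₂.finrank_eq]
    simp

/-- **A closed connected orientable smooth surface with `rank_ℤ H₁ = 2` is homeomorphic to the
torus `S¹ × S¹`** (comparison with the tree's torus model `exists_twoTorus_model`,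
`ClosedOrientableSurfaces.lean`: a closed connected smooth surface charted on `ℝ²`, `ℤ`-orientable
hence smoothly orientable — Bredon VI.7.15, `isOrientable_of_isOrientableOver_int` — with
`H₁ ≅ ℤ²`, homeomorphic to Mathlib's `Circle × Circle`). Hirsch (1976), Ch. 9 §3, Thm. 3.5;
Hatcher (2002), Example 2A.2. [cite: HirschDT1976, Ch. 9 §3, Thm. 3.5 and Thm. 3.11] -/
theorem nonempty_homeomorph_circle_prod_circle_of_isOrientable_of_finrank_eq_two (S : Type)
    [TopologicalSpace S] [T2Space S] [SecondCountableTopology S] [CompactSpace S]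
    [ConnectedSpace S] [ChartedSpace (EuclideanSpace ℝ (Fin 2)) S] [IsManifold (𝓡 2) ∞ S]
    (ho : IsOrientable (𝓡 2) S) (h1 : Module.finrank ℤ (singularHomology ℤ ℤ S 1) = 2) :
    Nonempty (S ≃ₜ Circle × Circle) := by
  obtain ⟨T, _, _, _, _, _, _, _, ⟨eT⟩, hO, ⟨lin⟩⟩ := exists_twoTorus_model
  have hT : Module.finrank ℤ (singularHomology ℤ ℤ T 1) = 2 := by
    rw [← lin.finrank_eq]
    simp
  obtain ⟨Φ⟩ := nonempty_diffeomorph_of_isOrientable_of_finrank_eq_two S T ho h1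
    (isOrientable_of_isOrientableOver_int T hO) hT
  exact ⟨Φ.toHomeomorph.trans eT⟩

end Literature.Topology.FourManifolds

end
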